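import Summits.ABC.ABC.Theorems.TwistAmplificationSharpModerateLawFewDeepFlat

/-!
# Crux `TwistAmplification.SharpModerateLaw` (stmt-ABC-1975), line `unit-plane-conic-two-torsion`:
calibration of the open core `stub_spreadCensus`

Registered sub-goal `spreadFlatLaw_of_spreadLawCone : SpreadLawCone → LawWithConeE SpreadFlat 1`
(objects of `…SharpModerateLawUnitPlaneDefs.lean`, `…SharpModerateLawDefs.lean`, `…ConeDefs.lean`): the
companion line's promoted open core `SpreadLawCone` (cone law on the NOT-few-deep data, syzygy normalisation)
implies this line's spread core `LawWithConeE SpreadFlat 1` (cone law on the flat spread-above-floor population),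
with the same constant. Together with the landed `stub_fewDeepFlat` (p117036) and `flatCover_glue` (p116320) the two
open cores are thus interchangeable for the planners.

Proof. For a datum `q = g·(u,v)` of a form `F`, `m = |F(u,v)| = primValue F q` and `m♭ = mflat F q ∣ m`
(`coprimePart_dvd`), so `p² ∣ m♭ ⇒ p² ∣ m`, i.e. `v(m♭) ∣ v(m)` for Kane's repeated radical `v = depthRad`
(`factorization_depthRad`), whence `v(m♭) ≤ v(m)` (`depthRad_mflat_le`). A spread datum has
`X·Y^{−1/6} < g·rad|Disc F|·v(m♭) ≤ g·rad|Disc F|·v(m)`, so it is NOT few-deep (`not_fewDeep_of_spreadFlat`; the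
companion's `FewDeep` spells `m` as `|F(q/gcd q)|`, which is `primValue F q` by `rfl`). Hence shell by shell
`shellCount (SpreadFlat ε) X Y F ≤ shellCount (¬FewDeep) X Y F` (`Set.ncard_le_ncard`, the larger set being finite by
`FewDeepSlice.finite_mplus_le` for maximal, hence nondegenerate, `F`; both sets are empty otherwise), orbit by orbit
(`orbitTotal_mono`) and in total (`totalCount_spreadFlat_le`), and `SpreadLawCone` bounds the right-hand side.
-/

noncomputable section

-- the mandated summit namespace `Summit.ABC.ABC` (summit = problem) trips the duplicate-namespace linter
set_option linter.dupNamespace false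

namespace Summit.ABC.ABC.Theorems.SharpModerateLaw.UnitPlane

open Literature.NumberTheory.CubicFields
open UniqueFactorizationMonoid (radical)
open scoped BigOperators
open Finset

/-! ## 1. The repeated radical is monotone under divisibility -/

/-- `a ∣ b ≠ 0 ⇒ v(a) ∣ v(b)` for Kane's repeated radical `v = depthRad` (`p² ∣ a ⇒ p² ∣ b`). -/
theorem depthRad_dvd_depthRad_of_dvd {a b : ℕ} (hab : a ∣ b) (hb : b ≠ 0) : depthRad a ∣ depthRad b := by
  have ha : a ≠ 0 := fun h => hb (Nat.eq_zero_of_zero_dvd (h ▸ hab))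
  rw [← Nat.factorization_le_iff_dvd (depthRad_pos a).ne' (depthRad_pos b).ne']
  intro p
  by_cases hp : p.Prime
  · rw [factorization_depthRad ha hp, factorization_depthRad hb hp]
    by_cases h2 : p ^ 2 ∣ a
    · rw [if_pos h2, if_pos (h2.trans hab)]
    · rw [if_neg h2]
      exact Nat.zero_le _
  · simp [Nat.factorization_eq_zero_of_not_prime _ hp]

/-- `coprimePart s 0 = 1` (empty product). -/
theorem coprimePart_zero (s : ℕ) : coprimePart s 0 = 1 := by
  simp [coprimePart]

/-- `v(1) = 1`. -/
theorem depthRad_one : depthRad 1 = 1 := Nat.dvd_one.mp (depthRad_dvd 1)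

/-- **`v(m♭) ≤ v(m)`**: the repeated radical of the flat part `m♭ = mflat F q` is at most that of
`m = primValue F q` (for `m = 0` both sides are harmless: `m♭ = 1`). -/
theorem depthRad_mflat_le (F : BinaryCubic ℤ) (q : ℤ × ℤ) :
    depthRad (mflat F q) ≤ depthRad (primValue F q) := by
  by_cases hm : primValue F q = 0
  · rw [mflat, hm, coprimePart_zero, depthRad_one]
    exact depthRad_pos 0
  · exact Nat.le_of_dvd (depthRad_pos _) (depthRad_dvd_depthRad_of_dvd (coprimePart_dvd _ hm) hm)

/-! ## 2. One datum: spread-above-floor data are not few-deep -/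

/-- **A flat spread datum is not few-deep** (syzygy normalisation): `X·Y^{−1/6} < g·rad|D|·v(m♭) ≤ g·rad|D|·v(m)`. -/
theorem not_fewDeep_of_spreadFlat {ε X Y : ℝ} {F : BinaryCubic ℤ} {q : ℤ × ℤ} (h : SpreadFlat ε X Y F q) :
    ¬ FewDeep X Y F q := by
  intro hfd
  have hle : ((depthRad (mflat F q) : ℕ) : ℝ) ≤ ((depthRad (primValue F q) : ℕ) : ℝ) := by
    exact_mod_cast depthRad_mflat_le F q
  have hA0 : 0 ≤ ((Int.gcd q.1 q.2 : ℕ) : ℝ) * ((radical F.disc.natAbs : ℕ) : ℝ) := by positivity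
  have h1 : ((Int.gcd q.1 q.2 : ℕ) : ℝ) * ((radical F.disc.natAbs : ℕ) : ℝ) * ((depthRad (mflat F q) : ℕ) : ℝ) ≤
      ((Int.gcd q.1 q.2 : ℕ) : ℝ) * ((radical F.disc.natAbs : ℕ) : ℝ) *
        ((depthRad (primValue F q) : ℕ) : ℝ) :=
    mul_le_mul_of_nonneg_left hle hA0
  have h2 : ((Int.gcd q.1 q.2 : ℕ) : ℝ) * ((radical F.disc.natAbs : ℕ) : ℝ) *
      ((depthRad (primValue F q) : ℕ) : ℝ) ≤ X * Y ^ (-(1 / 6 : ℝ)) := hfd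
  exact absurd (h.1.trans_le (h1.trans h2)) (lt_irrefl _)

/-! ## 3. Counting: `totalCount (SpreadFlat ε) X Y ≤ totalCount (¬FewDeep) X Y` -/

/-- Per form: the flat spread shell count is at most the not-few-deep shell count (both vanish unless `F` is
maximal; the larger set is finite by `FewDeepSlice.finite_mplus_le`). -/
theorem shellCount_spreadFlat_le (ε X Y : ℝ) (F : BinaryCubic ℤ) :
    shellCount (SpreadFlat ε) X Y F ≤ shellCount (fun X Y F q => ¬ FewDeep X Y F q) X Y F := by
  unfold shellCount
  by_cases hM : RingOfForm.IsMaximal F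
  · have hD : F.disc ≠ 0 := hM.disc_ne_zero
    refine Set.ncard_le_ncard (fun q hq => ⟨hq.1, hq.2.1, not_fewDeep_of_spreadFlat hq.2.2⟩) ?_
    exact (FewDeepSlice.finite_mplus_le hD ⌈2 * Y⌉₊).subset fun q hq => by
      have h : (Mplus F q : ℝ) < 2 * Y := hq.2.1.2.2.2.2.2.1
      exact_mod_cast (h.le.trans (Nat.le_ceil _) : (Mplus F q : ℝ) ≤ ⌈2 * Y⌉₊)
  · rw [Set.eq_empty_of_forall_notMem
        (s := {q : ℤ × ℤ | RingOfForm.IsMaximal F ∧ q ∈ ifShell F X Y ∧ SpreadFlat ε X Y F q})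
        fun q hq => hM hq.1, Set.ncard_empty]
    exact Nat.zero_le _

/-- **The count comparison**: `totalCount (SpreadFlat ε) X Y ≤ totalCount (¬FewDeep) X Y` (same discriminant
range, orbit by orbit). -/
theorem totalCount_spreadFlat_le (ε X Y : ℝ) :
    totalCount (SpreadFlat ε) X Y ≤ totalCount (fun X Y F q => ¬ FewDeep X Y F q) X Y := by
  unfold totalCount
  exact Finset.sum_le_sum fun D hD =>
    orbitTotal_mono (Finset.mem_erase.mp hD).1 fun F => shellCount_spreadFlat_le ε X Y F

/-! ## 4. The calibration -/

/-- **Registered sub-goal `spreadFlatLaw_of_spreadLawCone` of crux stmt-ABC-1975** (line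
`unit-plane-conic-two-torsion`): the companion's promoted open core `SpreadLawCone` implies the cone law on the
flat spread-above-floor population, with the same constant. -/
theorem spreadFlatLaw_of_spreadLawCone : SpreadLawCone → LawWithConeE SpreadFlat 1 := by
  intro h σ hσ ε hε
  obtain ⟨C, hC⟩ := h σ hσ ε hε
  refine ⟨C, fun X Y hX hY hc1 hc2 => ?_⟩
  have hcount : (totalCount (SpreadFlat ε) X Y : ℝ) ≤
      (totalCount (fun X Y F q => ¬ FewDeep X Y F q) X Y : ℝ) := by
    exact_mod_cast totalCount_spreadFlat_le ε X Y
  exact hcount.trans (hC X Y hX hY hc1 hc2)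

end Summit.ABC.ABC.Theorems.SharpModerateLaw.UnitPlane

end
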